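/-
Copyright (c) 2026. All rights reserved.
Released under Apache 2.0 license as described in the file LICENSE.
Authors: HodgeCM publication cell (pub-hodgecm), floor-0 programme P4 (engine E-2), prover `A-p12`.
-/
import Literature.NumberTheory.GelbartRogawski1991.UnitaryDualPairThetaKernelCM
import Literature.NumberTheory.Weil1964.AdelicMetaplecticImplementerModulusBound
import Literature.NumberTheory.Automorphic.UnitaryGroupOfFormAdelicTopology
import HarnessLib

/-!
# The `L²` moduli of the conjugated pair-splitting implementers over a compact set

Topic `NumberTheory/GelbartRogawski1991`; namespace `Literature.NumberTheory.GelbartRogawski1991.UnitaryDualPair`.  KERNEL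
MATHEMATICS ONLY (theorems over tree declarations; no definition, no named fact, no proof hole).  For a unitary dual pair
`(U(J_V), U(J_W))` with a continuous splitting `s : U(J_V ⊗ J_W)(𝔸) → Mp_ψ(𝕎_𝔸)ᶜᵒⁿᵗ`, a fixed `q ∈ Mp_ψ(𝕎_𝔸)ᶜᵒⁿᵗ` and a compact
`C ⊆ U(J_W)(𝔸)` (resp. `⊆ U(J_V)(𝔸)`), the `L²` moduli `L(q · s_pair(1,u) · q⁻¹)`, `u ∈ C`, lie in some `[c₁, c₂]` with `c₁ > 0`:
the modulus is conjugation-invariant and continuous along the coefficient-continuous homomorphism `u ↦ s_pair(1,u)`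
(★ `Weil1964.adelicMpCont.exists_pos_le_l2Scaling_conj_comp_of_isCompact`, Steinhaus–Weil), and `U(J)(𝔸)` is a second-countable
locally compact metrizable group (★ `UnitaryGroupOfFormAdelicTopology`).  This is the «moduli `≥ c₁ > 0`» conjunct of the
implementer hypothesis `hIMPL` of the boundedness step of the Siegel–Weil formula ([Weil1965] n° 47 Lemme 20, n° 50), in the binder
shape of the domination conjunct ★ `Weil1964.exists_piSchwartzBruhat_dominating_conj_cmPairSplitting_inr_two` (`∀ u ∈ C`, `C : Set ↥U`).

* `exists_pos_le_l2Scaling_conj_pairSplitting_inr` ∕ `_inl` — generic pair data `(F, E, c, e, J_V, J_W)`;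
* `exists_pos_le_l2Scaling_conj_cmPairSplitting_inr` ∕ `_inl` — the CM pin (`cmPairSplitting … hGR`);
* `exists_pos_le_l2Scaling_conj_cmPairSplitting_inr_of_gram_eq` — the same over a VARIABLE Gram matrix `T′ = adelicGram …` (the
  splitting cast along `hTe ▸`), so that a consumer whose metaplectic group is written over a propositionally equal Gram matrix
  (the doubled pair: `adelicGram (eD) = doubledGramFin (adelicGram e)`, ★ `Li1992.DoubledPair.adelicGram_eD_eq_doubledGramFin`)
  instantiates without a `subst` of its own — the shape of B-p12's domination probe `dominated_of_gram_eq`;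
* `exists_pos_le_l2Scaling_conj_pairSplitting_inr_of_gram_eq` ∕ `_inl_of_gram_eq` — the generic pair data in the same
  `(T′, hT′)`-arbitrary form (arbitrary symmetric `T_V`, `T_W`; the form the CM adapter at `hfib`'s generality consumes).
* (ED. 2) `exists_pos_le_l2Scaling_conj_comp_of_isCompact_of_subset` — HOM-ARBITRARY form: any coefficient-continuous
  `s : U(J_W)(𝔸) →* Mp_ψ(T)ᶜᵒⁿᵗ` (e.g. a congruence-transported splitting), the compact set given in the ambient `GL_M(𝔸_E)` with
  `hCU : C ⊆ U(J_W)(𝔸)` and read at `⟨k, hCU hk⟩` — the literal binder shape of the implementer hypothesis `hIMPL`.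
Cell `hodgecm-mathlib`, floor-0 line P4, engine E-2, crux H413, sheet `SW2c-BOUND-ASSEMBLY.v1` row (IMPL).

References: [Weil1964] A. Weil, Acta Math. 111 (1964), Chap. I n° 13 p. 160; [Weil1965] A. Weil, Acta Math. 113 (1965), n° 47
Lemma 20 and n° 50; [GelbartRogawski1991] S. Gelbart, J. Rogawski, §3.1 Prop. 3.1.1 p. 455 (the pair splitting).
-/

set_option autoImplicit false

noncomputable section

namespace Literature.NumberTheory.GelbartRogawski1991

namespace UnitaryDualPair

open Literature.NumberTheory.Automorphic Literature.NumberTheory.Weil1964 Literature.RepresentationTheory.HeisenbergGroup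
open NumberField _root_.MeasureTheory

/-! ## §1 Generic pair data -/

section Generic

variable (F E : Type) [Field F] [NumberField F] [Field E] [NumberField E] [Algebra F E]
variable (c : E ≃ₐ[F] E) (N M : ℕ) {n : ℕ} (e : Fin N × Fin M ≃ Fin n)
variable (JV : Matrix (Fin N) (Fin N) E) (JW : Matrix (Fin M) (Fin M) E)
variable {TV : Matrix (Fin N) (Fin N) F} {TW : Matrix (Fin M) (Fin M) F} (hT : IsUnit (adelicGram F e TV TW).det)
variable [MeasurableSpace (AdeleRing (𝓞 F) F)] [BorelSpace (AdeleRing (𝓞 F) F)]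
  (νX : Measure (Fin n → AdeleRing (𝓞 F) F)) [νX.IsAddHaarMeasure]
  (s : UnitaryGroup.adelicPair F E c N M JV JW →* adelicMpCont F (Fin n) (adelicGram F e TV TW)) (hsc : Continuous s)
  (q : adelicMpCont F (Fin n) (adelicGram F e TV TW))

include hsc in
/-- **THE MODULI OF THE `W`-SIDE IMPLEMENTERS OVER A COMPACT SET**: for a continuous splitting `s`, a fixed `q` and a compact
`C ⊆ U(J_W)(𝔸)` there are `0 < c₁`, `c₂` with `c₁ ≤ L(q · s_pair(1,u) · q⁻¹) ≤ c₂` for all `u ∈ C` (any determinant witness `hT`,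
arbitrary symmetric `T_V`, `T_W`).
[cite: Weil1965, n° 47 Lemma 20 and n° 50] [cite: Weil1964, Chap. I n° 13 p. 160] [cite: GelbartRogawski1991, §3.1 Prop. 3.1.1 p. 455 L1–3] -/
theorem exists_pos_le_l2Scaling_conj_pairSplitting_inr {C : Set (UnitaryGroup.adelic F E c M JW)} (hC : IsCompact C) :
    ∃ c₁ c₂ : ℝ, 0 < c₁ ∧ ∀ u ∈ C,
      c₁ ≤ (adelicMpCont.l2Scaling F (adelicGram F e TV TW) hT νX
          (q * pairSplitting F E c N M e JV JW s (1, u) * q⁻¹)).toReal ∧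
        (adelicMpCont.l2Scaling F (adelicGram F e TV TW) hT νX
          (q * pairSplitting F E c N M e JV JW s (1, u) * q⁻¹)).toReal ≤ c₂ := by
  borelize ↥(UnitaryGroup.adelic F E c M JW)
  have ht : Continuous fun g : UnitaryGroup.adelic F E c M JW =>
      (((pairSplitting F E c N M e JV JW s).comp (MonoidHom.inr _ _) g :
        adelicMpCont F (Fin n) (adelicGram F e TV TW)) : adelicMp F (Fin n) (adelicGram F e TV TW)) :=
    continuous_subtype_val.comp ((continuous_pairSplitting F E c N M e JV JW hsc).comp (continuous_const.prodMk continuous_id))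
  have h₀ := adelicMpCont.exists_pos_le_l2Scaling_conj_comp_of_isCompact F (adelicGram F e TV TW) hT νX
    ((pairSplitting F E c N M e JV JW s).comp (MonoidHom.inr _ _)) ht q hC
  exact h₀

include hsc in
/-- the `V`-side twin: `c₁ ≤ L(q · s_pair(g,1) · q⁻¹) ≤ c₂` for `g` in a compact `C ⊆ U(J_V)(𝔸)`.
[cite: Weil1965, n° 47 Lemma 20 and n° 50] [cite: Weil1964, Chap. I n° 13 p. 160] [cite: GelbartRogawski1991, §3.1 Prop. 3.1.1 p. 455 L1–3] -/
theorem exists_pos_le_l2Scaling_conj_pairSplitting_inl {C : Set (UnitaryGroup.adelic F E c N JV)} (hC : IsCompact C) :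
    ∃ c₁ c₂ : ℝ, 0 < c₁ ∧ ∀ g ∈ C,
      c₁ ≤ (adelicMpCont.l2Scaling F (adelicGram F e TV TW) hT νX
          (q * pairSplitting F E c N M e JV JW s (g, 1) * q⁻¹)).toReal ∧
        (adelicMpCont.l2Scaling F (adelicGram F e TV TW) hT νX
          (q * pairSplitting F E c N M e JV JW s (g, 1) * q⁻¹)).toReal ≤ c₂ := by
  borelize ↥(UnitaryGroup.adelic F E c N JV)
  have ht : Continuous fun g : UnitaryGroup.adelic F E c N JV =>
      (((pairSplitting F E c N M e JV JW s).comp (MonoidHom.inl _ _) g :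
        adelicMpCont F (Fin n) (adelicGram F e TV TW)) : adelicMp F (Fin n) (adelicGram F e TV TW)) :=
    continuous_subtype_val.comp ((continuous_pairSplitting F E c N M e JV JW hsc).comp (continuous_id.prodMk continuous_const))
  have h₀ := adelicMpCont.exists_pos_le_l2Scaling_conj_comp_of_isCompact F (adelicGram F e TV TW) hT νX
    ((pairSplitting F E c N M e JV JW s).comp (MonoidHom.inl _ _)) ht q hC
  exact h₀

end Generic

/-! ## §2 The CM pin -/

section CM

variable (L : Type) [Field L] [NumberField L] [IsCMField L] {N M n : ℕ} (e : Fin N × Fin M ≃ Fin n)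
  (dV : Fin N → L) (hdV : ∀ i, IsCMField.complexConj L (dV i) = dV i) (hdV0 : ∀ i, dV i ≠ 0)
  (dW : Fin M → L) (hdW : ∀ i, IsCMField.complexConj L (dW i) = dW i) (hdW0 : ∀ i, dW i ≠ 0)
  (hGR : (cmSplittingDatum L e dV hdV hdV0 dW hdW hdW0).CompatibleSplitting)
variable [MeasurableSpace (AdeleRing (𝓞 ↥(maximalRealSubfield L)) ↥(maximalRealSubfield L))]
  [BorelSpace (AdeleRing (𝓞 ↥(maximalRealSubfield L)) ↥(maximalRealSubfield L))]
  (νX : Measure (Fin n → AdeleRing (𝓞 ↥(maximalRealSubfield L)) ↥(maximalRealSubfield L))) [νX.IsAddHaarMeasure]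
  (q : adelicMpCont (↥(maximalRealSubfield L)) (Fin n)
    (adelicGram (↥(maximalRealSubfield L)) e (realDiagonal L dV hdV) (realDiagonal L dW hdW)))

/-- **THE `hIMPL` MODULUS CONJUNCT AT THE CM PIN** (binder shape of ★ `exists_piSchwartzBruhat_dominating_conj_cmPairSplitting_inr_two`):
for the chosen compatible CM pair splitting, a fixed `q` and a compact `C ⊆ U(diag d_W)(𝔸_{L⁺})`, the moduli
`L(q · s_pair(1,u) · q⁻¹)`, `u ∈ C`, lie in `[c₁, c₂]` with `0 < c₁`.
[cite: Weil1965, n° 47 Lemma 20 and n° 50] [cite: Weil1964, Chap. I n° 13 p. 160] [cite: GelbartRogawski1991, §3.1 Prop. 3.1.1 p. 455 L1–3] -/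
theorem exists_pos_le_l2Scaling_conj_cmPairSplitting_inr
    {C : Set ↥(UnitaryGroup.adelic (↥(maximalRealSubfield L)) L (IsCMField.complexConj L) M (Matrix.diagonal dW))}
    (hC : IsCompact C) :
    ∃ c₁ c₂ : ℝ, 0 < c₁ ∧ ∀ u ∈ C,
      c₁ ≤ (adelicMpCont.l2Scaling (↥(maximalRealSubfield L))
          (adelicGram (↥(maximalRealSubfield L)) e (realDiagonal L dV hdV) (realDiagonal L dW hdW))
          (isUnit_det_adelicGram (↥(maximalRealSubfield L)) e (isUnit_det_realDiagonal L dV hdV hdV0)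
            (isUnit_det_realDiagonal L dW hdW hdW0)) νX
          (q * cmPairSplitting L e dV hdV hdV0 dW hdW hdW0 hGR (1, u) * q⁻¹)).toReal ∧
        (adelicMpCont.l2Scaling (↥(maximalRealSubfield L))
          (adelicGram (↥(maximalRealSubfield L)) e (realDiagonal L dV hdV) (realDiagonal L dW hdW))
          (isUnit_det_adelicGram (↥(maximalRealSubfield L)) e (isUnit_det_realDiagonal L dV hdV hdV0)
            (isUnit_det_realDiagonal L dW hdW hdW0)) νX
          (q * cmPairSplitting L e dV hdV hdV0 dW hdW hdW0 hGR (1, u) * q⁻¹)).toReal ≤ c₂ :=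
  exists_pos_le_l2Scaling_conj_pairSplitting_inr (↥(maximalRealSubfield L)) L (IsCMField.complexConj L) N M e
    (Matrix.diagonal dV) (Matrix.diagonal dW)
    (isUnit_det_adelicGram (↥(maximalRealSubfield L)) e (isUnit_det_realDiagonal L dV hdV hdV0) (isUnit_det_realDiagonal L dW hdW hdW0))
    νX _ (continuous_splittingOf _ _ _ _ _ _ _ _ _ _ _ _ _ _ _ _ _ hGR) q hC

/-- the `V`-side twin at the CM pin: `c₁ ≤ L(q · s_pair(g,1) · q⁻¹) ≤ c₂` for `g` in a compact `C ⊆ U(diag d_V)(𝔸_{L⁺})`.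
[cite: Weil1965, n° 47 Lemma 20 and n° 50] [cite: Weil1964, Chap. I n° 13 p. 160] [cite: GelbartRogawski1991, §3.1 Prop. 3.1.1 p. 455 L1–3] -/
theorem exists_pos_le_l2Scaling_conj_cmPairSplitting_inl
    {C : Set ↥(UnitaryGroup.adelic (↥(maximalRealSubfield L)) L (IsCMField.complexConj L) N (Matrix.diagonal dV))}
    (hC : IsCompact C) :
    ∃ c₁ c₂ : ℝ, 0 < c₁ ∧ ∀ g ∈ C,
      c₁ ≤ (adelicMpCont.l2Scaling (↥(maximalRealSubfield L))
          (adelicGram (↥(maximalRealSubfield L)) e (realDiagonal L dV hdV) (realDiagonal L dW hdW))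
          (isUnit_det_adelicGram (↥(maximalRealSubfield L)) e (isUnit_det_realDiagonal L dV hdV hdV0)
            (isUnit_det_realDiagonal L dW hdW hdW0)) νX
          (q * cmPairSplitting L e dV hdV hdV0 dW hdW hdW0 hGR (g, 1) * q⁻¹)).toReal ∧
        (adelicMpCont.l2Scaling (↥(maximalRealSubfield L))
          (adelicGram (↥(maximalRealSubfield L)) e (realDiagonal L dV hdV) (realDiagonal L dW hdW))
          (isUnit_det_adelicGram (↥(maximalRealSubfield L)) e (isUnit_det_realDiagonal L dV hdV hdV0)
            (isUnit_det_realDiagonal L dW hdW hdW0)) νX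
          (q * cmPairSplitting L e dV hdV hdV0 dW hdW hdW0 hGR (g, 1) * q⁻¹)).toReal ≤ c₂ :=
  exists_pos_le_l2Scaling_conj_pairSplitting_inl (↥(maximalRealSubfield L)) L (IsCMField.complexConj L) N M e
    (Matrix.diagonal dV) (Matrix.diagonal dW)
    (isUnit_det_adelicGram (↥(maximalRealSubfield L)) e (isUnit_det_realDiagonal L dV hdV hdV0) (isUnit_det_realDiagonal L dW hdW hdW0))
    νX _ (continuous_splittingOf _ _ _ _ _ _ _ _ _ _ _ _ _ _ _ _ _ hGR) q hC

/-- **THE SAME OVER A VARIABLE GRAM MATRIX** `T′` (`hTe : adelicGram … = T′`, the splitting cast along `hTe ▸`, any determinant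
witness `hT′`): the shape a consumer over a propositionally-equal Gram matrix instantiates directly (`subst`-free at the call site).
[cite: Weil1965, n° 47 Lemma 20 and n° 50] [cite: Weil1964, Chap. I n° 13 p. 160] [cite: GelbartRogawski1991, §3.1 Prop. 3.1.1 p. 455 L1–3] -/
theorem exists_pos_le_l2Scaling_conj_cmPairSplitting_inr_of_gram_eq
    {T' : Matrix (Fin n) (Fin n) (AdeleRing (𝓞 ↥(maximalRealSubfield L)) ↥(maximalRealSubfield L))}
    (hTe : adelicGram (↥(maximalRealSubfield L)) e (realDiagonal L dV hdV) (realDiagonal L dW hdW) = T')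
    (hT' : IsUnit T'.det) (q' : adelicMpCont (↥(maximalRealSubfield L)) (Fin n) T')
    {C : Set ↥(UnitaryGroup.adelic (↥(maximalRealSubfield L)) L (IsCMField.complexConj L) M (Matrix.diagonal dW))}
    (hC : IsCompact C) :
    ∃ c₁ c₂ : ℝ, 0 < c₁ ∧ ∀ u ∈ C,
      c₁ ≤ (adelicMpCont.l2Scaling (↥(maximalRealSubfield L)) T' hT' νX
          (q' * (hTe ▸ cmPairSplitting L e dV hdV hdV0 dW hdW hdW0 hGR :
              ↥(UnitaryGroup.adelic (↥(maximalRealSubfield L)) L (IsCMField.complexConj L) N (Matrix.diagonal dV)) ×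
                  ↥(UnitaryGroup.adelic (↥(maximalRealSubfield L)) L (IsCMField.complexConj L) M (Matrix.diagonal dW)) →*
                adelicMpCont (↥(maximalRealSubfield L)) (Fin n) T') (1, u) * q'⁻¹)).toReal ∧
        (adelicMpCont.l2Scaling (↥(maximalRealSubfield L)) T' hT' νX
          (q' * (hTe ▸ cmPairSplitting L e dV hdV hdV0 dW hdW hdW0 hGR :
              ↥(UnitaryGroup.adelic (↥(maximalRealSubfield L)) L (IsCMField.complexConj L) N (Matrix.diagonal dV)) ×
                  ↥(UnitaryGroup.adelic (↥(maximalRealSubfield L)) L (IsCMField.complexConj L) M (Matrix.diagonal dW)) →*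
                adelicMpCont (↥(maximalRealSubfield L)) (Fin n) T') (1, u) * q'⁻¹)).toReal ≤ c₂ := by
  subst hTe
  exact exists_pos_le_l2Scaling_conj_cmPairSplitting_inr L e dV hdV hdV0 dW hdW hdW0 hGR νX q' hC

end CM

/-! ## §3 Generic pair data over a variable Gram matrix -/

section GenericGram

variable (F E : Type) [Field F] [NumberField F] [Field E] [NumberField E] [Algebra F E]
variable (c : E ≃ₐ[F] E) (N M : ℕ) {n : ℕ} (e : Fin N × Fin M ≃ Fin n)
variable (JV : Matrix (Fin N) (Fin N) E) (JW : Matrix (Fin M) (Fin M) E)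
variable {TV : Matrix (Fin N) (Fin N) F} {TW : Matrix (Fin M) (Fin M) F}
variable [MeasurableSpace (AdeleRing (𝓞 F) F)] [BorelSpace (AdeleRing (𝓞 F) F)]
  (νX : Measure (Fin n → AdeleRing (𝓞 F) F)) [νX.IsAddHaarMeasure]
  (s : UnitaryGroup.adelicPair F E c N M JV JW →* adelicMpCont F (Fin n) (adelicGram F e TV TW)) (hsc : Continuous s)
  {T' : Matrix (Fin n) (Fin n) (AdeleRing (𝓞 F) F)} (hTe : adelicGram F e TV TW = T') (hT' : IsUnit T'.det)
  (q' : adelicMpCont F (Fin n) T')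

include hsc in
/-- **THE `W`-SIDE MODULI OVER A VARIABLE GRAM MATRIX** `T′` (`hTe : adelicGram F e T_V T_W = T′`, the splitting cast along `hTe ▸`,
any determinant witness `hT′`; arbitrary symmetric `T_V`, `T_W`): `0 < c₁ ≤ L(q′ · s_pair(1,u) · q′⁻¹) ≤ c₂` on a compact `C ⊆ U(J_W)(𝔸)`.
[cite: Weil1965, n° 47 Lemma 20 and n° 50] [cite: Weil1964, Chap. I n° 13 p. 160] [cite: GelbartRogawski1991, §3.1 Prop. 3.1.1 p. 455 L1–3] -/
theorem exists_pos_le_l2Scaling_conj_pairSplitting_inr_of_gram_eq {C : Set (UnitaryGroup.adelic F E c M JW)}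
    (hC : IsCompact C) :
    ∃ c₁ c₂ : ℝ, 0 < c₁ ∧ ∀ u ∈ C,
      c₁ ≤ (adelicMpCont.l2Scaling F T' hT' νX
          (q' * (hTe ▸ pairSplitting F E c N M e JV JW s :
              UnitaryGroup.adelic F E c N JV × UnitaryGroup.adelic F E c M JW →* adelicMpCont F (Fin n) T') (1, u) *
            q'⁻¹)).toReal ∧
        (adelicMpCont.l2Scaling F T' hT' νX
          (q' * (hTe ▸ pairSplitting F E c N M e JV JW s :
              UnitaryGroup.adelic F E c N JV × UnitaryGroup.adelic F E c M JW →* adelicMpCont F (Fin n) T') (1, u) *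
            q'⁻¹)).toReal ≤ c₂ := by
  subst hTe
  exact exists_pos_le_l2Scaling_conj_pairSplitting_inr F E c N M e JV JW hT' νX s hsc q' hC

include hsc in
/-- the `V`-side twin over a variable Gram matrix: `0 < c₁ ≤ L(q′ · s_pair(g,1) · q′⁻¹) ≤ c₂` on a compact `C ⊆ U(J_V)(𝔸)`.
[cite: Weil1965, n° 47 Lemma 20 and n° 50] [cite: Weil1964, Chap. I n° 13 p. 160] [cite: GelbartRogawski1991, §3.1 Prop. 3.1.1 p. 455 L1–3] -/
theorem exists_pos_le_l2Scaling_conj_pairSplitting_inl_of_gram_eq {C : Set (UnitaryGroup.adelic F E c N JV)}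
    (hC : IsCompact C) :
    ∃ c₁ c₂ : ℝ, 0 < c₁ ∧ ∀ g ∈ C,
      c₁ ≤ (adelicMpCont.l2Scaling F T' hT' νX
          (q' * (hTe ▸ pairSplitting F E c N M e JV JW s :
              UnitaryGroup.adelic F E c N JV × UnitaryGroup.adelic F E c M JW →* adelicMpCont F (Fin n) T') (g, 1) *
            q'⁻¹)).toReal ∧
        (adelicMpCont.l2Scaling F T' hT' νX
          (q' * (hTe ▸ pairSplitting F E c N M e JV JW s :
              UnitaryGroup.adelic F E c N JV × UnitaryGroup.adelic F E c M JW →* adelicMpCont F (Fin n) T') (g, 1) *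
            q'⁻¹)).toReal ≤ c₂ := by
  subst hTe
  exact exists_pos_le_l2Scaling_conj_pairSplitting_inl F E c N M e JV JW hT' νX s hsc q' hC

end GenericGram

/-! ## §4 Hom-arbitrary form over a compact subset of the ambient `GL_M(𝔸_E)` (ED. 2) -/

section Subset

variable (F E : Type) [Field F] [NumberField F] [Field E] [NumberField E] [Algebra F E]
variable (c : E ≃ₐ[F] E) (M : ℕ) (JW : Matrix (Fin M) (Fin M) E) {m : ℕ}
variable (T : Matrix (Fin m) (Fin m) (AdeleRing (𝓞 F) F)) (hT : IsUnit T.det)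
variable [MeasurableSpace (AdeleRing (𝓞 F) F)] [BorelSpace (AdeleRing (𝓞 F) F)]
  (ν : Measure (Fin m → AdeleRing (𝓞 F) F)) [ν.IsAddHaarMeasure]
  (s : UnitaryGroup.adelic F E c M JW →* adelicMpCont F (Fin m) T) (hs : Continuous fun g => (s g : adelicMp F (Fin m) T))
  (u : adelicMpCont F (Fin m) T)

include hs in
/-- **THE `hIMPL` MODULUS CONJUNCT, HOM-ARBITRARY**: for ANY coefficient-continuous homomorphism `s : U(J_W)(𝔸) → Mp_ψ(T)ᶜᵒⁿᵗ`
(`T` arbitrary — e.g. the doubled Gram matrix — and `s` e.g. a congruence-transported pair splitting `k ↦ s_pair(1,k)`), a fixed `u`,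
and a compact `C ⊆ GL_M(𝔸_E)` contained in `U(J_W)(𝔸)`: `0 < c₁ ≤ L(u · s(k) · u⁻¹) ≤ c₂` for all `k ∈ C` (read at `⟨k, hCU hk⟩`;
`U(J_W)(𝔸)` carries the subspace topology, so `C` pulls back to a compact subset of it).
[cite: Weil1965, n° 47 Lemma 20 and n° 50] [cite: Weil1964, Chap. I n° 13 p. 160] [cite: GelbartRogawski1991, §3.1 Prop. 3.1.1 p. 455 L1–3] -/
theorem exists_pos_le_l2Scaling_conj_comp_of_isCompact_of_subset {C : Set (GL (Fin M) (AdeleRing (𝓞 E) E))}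
    (hC : IsCompact C) (hCU : C ⊆ UnitaryGroup.adelic F E c M JW) :
    ∃ c₁ c₂ : ℝ, 0 < c₁ ∧ ∀ (k : GL (Fin M) (AdeleRing (𝓞 E) E)) (hk : k ∈ C),
      c₁ ≤ (adelicMpCont.l2Scaling F T hT ν (u * s ⟨k, hCU hk⟩ * u⁻¹)).toReal ∧
        (adelicMpCont.l2Scaling F T hT ν (u * s ⟨k, hCU hk⟩ * u⁻¹)).toReal ≤ c₂ := by
  borelize ↥(UnitaryGroup.adelic F E c M JW)
  have hC' : IsCompact ((Subtype.val : UnitaryGroup.adelic F E c M JW → GL (Fin M) (AdeleRing (𝓞 E) E)) ⁻¹' C) :=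
    Topology.IsInducing.subtypeVal.isCompact_preimage' hC (by rwa [Subtype.range_coe_subtype])
  have h₀ := adelicMpCont.exists_pos_le_l2Scaling_conj_comp_of_isCompact F T hT ν s hs u hC'
  rcases h₀ with ⟨c₁, c₂, hc₁, h⟩
  exact ⟨c₁, c₂, hc₁, fun k hk => h ⟨k, hCU hk⟩ hk⟩

end Subset

end UnitaryDualPair

end Literature.NumberTheory.GelbartRogawski1991
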